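import Mathlib

/-!
# Manin–Gamma cell (pub-manin-gamma0): `Γ₀(M₁) ⊔ Γ₀(M₂) = Γ₀(gcd(M₁, M₂))` (seat p1, gen 2) — task (L-SM1)

This is the group-theoretic identity used in `proofs/T1_lead.md` §0.4 (SM1)(c) («LEVEL = CONDUCTOR»,
Atkin–Lehner-free): a weight-2 form invariant under `Γ₀(N)` and under `Γ₀(N_E)` is invariant under the
subgroup they generate, which is `Γ₀(gcd(N, N_E))`.  We prove it in Mathlib's `SL(2, ℤ)` with
`CongruenceSubgroup.Gamma0`, by an explicit elementwise factorisation (no finite-group CRT bookkeeping):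
for `A = (a b; c d) ∈ Γ₀(g)`, choose `s` with `gcd(c s + d, M₂) = 1` (`exists_shift_isCoprime`), then
`t ∈ M₁ℤ` with `c + (c s + d) t ≡ 0 (mod M₂)` (Bezout for `g = gcd(M₁,M₂) ∣ c`); then
`A · U(s) · L(t) ∈ Γ₀(M₂)` with `U(s) = (1 s; 0 1)`, `L(t) = (1 0; t 1) ∈ Γ₀(M₁)`.

Main results:
* `ManinGamma.GammaZeroSup.exists_shift_isCoprime` — `IsCoprime c d → M ≠ 0 → ∃ s, IsCoprime (c*s + d) M`.
* `ManinGamma.GammaZeroSup.Gamma0_antitone` — `d ∣ M → Γ₀(M) ≤ Γ₀(d)`.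
* `ManinGamma.GammaZeroSup.mul_mul_apply_10` — lower-left entry of a triple product.
* `ManinGamma.GammaZeroSup.Gamma0_sup_Gamma0` — `Γ₀(M₁) ⊔ Γ₀(M₂) = Γ₀(Nat.gcd M₁ M₂)` (all `M₁, M₂ : ℕ`,
  with Mathlib's conventions `Γ₀(0) = {c = 0}`, `gcd(M, 0) = M`).
Only Mathlib is imported; no `sorry`.
-/

namespace ManinGamma.GammaZeroSup

open CongruenceSubgroup Matrix MatrixGroups

/-! ### Arithmetic: a shift of `d` by a multiple of `c` coprime to a given modulus -/

/-- If `c, d` are coprime integers and `M ≠ 0`, then `c * s + d` is coprime to `M` for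
`s :=` the product of the prime factors of `M` that do not divide `d`. -/
theorem exists_shift_isCoprime {c d : ℤ} (hcd : IsCoprime c d) (M : ℕ) (hM : M ≠ 0) :
    ∃ s : ℤ, IsCoprime (c * s + d) (M : ℤ) := by
  classical
  let S : Finset ℕ := M.primeFactors.filter (fun p => ¬ ((p : ℤ) ∣ d))
  refine ⟨∏ p ∈ S, (p : ℤ), ?_⟩
  set s : ℤ := ∏ p ∈ S, (p : ℤ) with hs_def
  have hgcd : Int.gcd c d = 1 := Int.isCoprime_iff_gcd_eq_one.mp hcd
  rw [Int.isCoprime_iff_gcd_eq_one]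
  -- `Int.gcd x y = Nat.gcd |x| |y|`
  change Nat.Coprime (c * s + d).natAbs ((M : ℤ)).natAbs
  rw [Int.natAbs_natCast]
  apply Nat.coprime_of_dvd
  intro k hk hkx hkM
  -- translate the hypotheses to divisibilities in ℤ
  have hkZ : Prime (k : ℤ) := Nat.prime_iff_prime_int.mp hk
  have hkx' : (k : ℤ) ∣ c * s + d := by
    rwa [← Int.natAbs_dvd_natAbs, Int.natAbs_natCast]
  by_cases hkd : (k : ℤ) ∣ d
  · -- then k ∤ s and k ∤ c, contradiction with k ∣ c s + d
    have hks : ¬ (k : ℤ) ∣ s := by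
      intro h
      rw [hs_def] at h
      obtain ⟨p, hpS, hkp⟩ := (hkZ.dvd_finsetProd_iff (fun p : ℕ => (p : ℤ))).mp h
      have hp : p.Prime := Nat.prime_of_mem_primeFactors (Finset.mem_filter.mp hpS).1
      have hpd : ¬ ((p : ℤ) ∣ d) := (Finset.mem_filter.mp hpS).2
      have hkp' : k ∣ p := by exact_mod_cast hkp
      have : k = p := (Nat.prime_dvd_prime_iff_eq hk hp).mp hkp'
      subst this
      exact hpd hkd
    have hkc : ¬ (k : ℤ) ∣ c := by
      intro h
      have h1 : k ∣ c.natAbs := by rwa [← Int.natAbs_dvd_natAbs, Int.natAbs_natCast] at h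
      have h2 : k ∣ d.natAbs := by rwa [← Int.natAbs_dvd_natAbs, Int.natAbs_natCast] at hkd
      have h3 : k ∣ Int.gcd c d := Nat.dvd_gcd h1 h2
      rw [hgcd] at h3
      exact hk.one_lt.ne' (Nat.dvd_one.mp h3)
    have hkcs : ¬ (k : ℤ) ∣ c * s := by
      intro h
      rcases hkZ.dvd_or_dvd h with h' | h'
      · exact hkc h'
      · exact hks h'
    apply hkcs
    have : c * s = (c * s + d) - d := by ring
    rw [this]
    exact dvd_sub hkx' hkd
  · -- then k ∈ S, so k ∣ s ∣ c s, and k ∣ d after all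
    have hkS : k ∈ S := by
      refine Finset.mem_filter.mpr ⟨?_, hkd⟩
      exact Nat.mem_primeFactors.mpr ⟨hk, hkM, hM⟩
    have hks : (k : ℤ) ∣ s := by
      rw [hs_def]; exact Finset.dvd_prod_of_mem (fun p : ℕ => (p : ℤ)) hkS
    apply hkd
    have : d = (c * s + d) - c * s := by ring
    rw [this]
    exact dvd_sub hkx' (dvd_mul_of_dvd_right hks c)

/-! ### Monotonicity and the main theorem -/

/-- `Γ₀` is antitone in the divisibility order: `d ∣ M ⟹ Γ₀(M) ≤ Γ₀(d)`. -/
theorem Gamma0_antitone {d M : ℕ} (h : d ∣ M) : Gamma0 M ≤ Gamma0 d := by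
  intro A hA
  rw [Gamma0_mem, ZMod.intCast_zmod_eq_zero_iff_dvd] at hA ⊢
  exact dvd_trans (Int.natCast_dvd_natCast.mpr h) hA

/-- Lower-left entry of a triple product in `SL(2, ℤ)` in terms of entries. -/
theorem mul_mul_apply_10 (A P Q : SL(2, ℤ)) :
    (A * P * Q) 1 0 = (A 1 0 * P 0 0 + A 1 1 * P 1 0) * Q 0 0 + (A 1 0 * P 0 1 + A 1 1 * P 1 1) * Q 1 0 := by
  simp [Matrix.mul_apply, Fin.sum_univ_two]

/-- **(L-SM1)** `Γ₀(M₁) ⊔ Γ₀(M₂) = Γ₀(gcd(M₁, M₂))` in `SL(2, ℤ)`. -/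
theorem Gamma0_sup_Gamma0 (M₁ M₂ : ℕ) :
    Gamma0 M₁ ⊔ Gamma0 M₂ = Gamma0 (Nat.gcd M₁ M₂) := by
  apply le_antisymm
  · exact sup_le (Gamma0_antitone (Nat.gcd_dvd_left _ _)) (Gamma0_antitone (Nat.gcd_dvd_right _ _))
  intro A hA
  -- degenerate levels
  rcases Nat.eq_zero_or_pos M₂ with h2 | h2
  · subst h2
    rw [Nat.gcd_zero_right] at hA
    exact Subgroup.mem_sup_left hA
  rcases Nat.eq_zero_or_pos M₁ with h1 | h1
  · subst h1
    rw [Nat.gcd_zero_left] at hA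
    exact Subgroup.mem_sup_right hA
  -- main case: entries and the hypothesis `g ∣ c`
  set g : ℕ := Nat.gcd M₁ M₂ with hg
  set c : ℤ := A 1 0 with hc
  set d : ℤ := A 1 1 with hd
  have hgc : (g : ℤ) ∣ c := by
    have := hA; rw [Gamma0_mem, ZMod.intCast_zmod_eq_zero_iff_dvd] at this; exact this
  obtain ⟨c₀, hc₀⟩ := hgc
  have hcd : IsCoprime c d := SpecialLinearGroup.isCoprime_row A 1
  -- Step 1: shift d to d' = c s + d coprime to M₂
  obtain ⟨s, hs⟩ := exists_shift_isCoprime hcd M₂ h2.ne'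
  set d' : ℤ := c * s + d with hd'
  obtain ⟨e, f, hef⟩ := hs          -- e * d' + f * M₂ = 1
  -- Step 2: Bezout for g and the choice of t ∈ M₁ ℤ
  have hbez : (g : ℤ) = (M₁ : ℤ) * Nat.gcdA M₁ M₂ + (M₂ : ℤ) * Nat.gcdB M₁ M₂ := Nat.gcd_eq_gcd_ab M₁ M₂
  set x : ℤ := Nat.gcdA M₁ M₂
  set y : ℤ := Nat.gcdB M₁ M₂
  set t : ℤ := (M₁ : ℤ) * (-(e * c₀ * x)) with ht
  have htM₁ : (M₁ : ℤ) ∣ t := ⟨_, rfl⟩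
  have hdiv : (M₂ : ℤ) ∣ c + d' * t := by
    refine ⟨c₀ * ((M₁ : ℤ) * x * f + y), ?_⟩
    have hf : 1 - e * d' = f * (M₂ : ℤ) := by linarith
    calc c + d' * t = (g : ℤ) * c₀ - d' * e * c₀ * x * (M₁ : ℤ) := by rw [hc₀, ht]; ring
      _ = ((M₁ : ℤ) * x + (M₂ : ℤ) * y) * c₀ - d' * e * c₀ * x * (M₁ : ℤ) := by rw [hbez]
      _ = c₀ * ((M₁ : ℤ) * x * (1 - e * d') + (M₂ : ℤ) * y) := by ring
      _ = c₀ * ((M₁ : ℤ) * x * (f * (M₂ : ℤ)) + (M₂ : ℤ) * y) := by rw [hf]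
      _ = (M₂ : ℤ) * (c₀ * ((M₁ : ℤ) * x * f + y)) := by ring
  -- Step 3: the factorisation A · U(s) · L(t) ∈ Γ₀(M₂) with U(s) = (1 s; 0 1), L(t) = (1 0; t 1) ∈ Γ₀(M₁)
  let P : SL(2, ℤ) := ⟨!![1, s; 0, 1], by simp [Matrix.det_fin_two_of]⟩
  let Q : SL(2, ℤ) := ⟨!![1, 0; t, 1], by simp [Matrix.det_fin_two_of]⟩
  have hP00 : P 0 0 = 1 := rfl
  have hP01 : P 0 1 = s := rfl
  have hP10 : P 1 0 = 0 := rfl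
  have hP11 : P 1 1 = 1 := rfl
  have hQ00 : Q 0 0 = 1 := rfl
  have hQ10 : Q 1 0 = t := rfl
  have hPmem : P ∈ Gamma0 M₁ := by
    rw [Gamma0_mem, hP10]; simp
  have hQmem : Q ∈ Gamma0 M₁ := by
    rw [Gamma0_mem, hQ10, ZMod.intCast_zmod_eq_zero_iff_dvd]; exact htM₁
  set B : SL(2, ℤ) := A * P * Q with hB
  have hB10 : B 1 0 = c + d' * t := by
    rw [hB, mul_mul_apply_10, hP00, hP01, hP10, hP11, hQ00, hQ10]
    simp only [hc, hd, hd']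
    ring
  have hBmem : B ∈ Gamma0 M₂ := by
    rw [Gamma0_mem, hB10, ZMod.intCast_zmod_eq_zero_iff_dvd]
    exact hdiv
  have hA_eq : A = B * Q⁻¹ * P⁻¹ := by
    rw [hB]; group
  rw [hA_eq]
  refine Subgroup.mul_mem _ (Subgroup.mul_mem _ (Subgroup.mem_sup_right hBmem) ?_) ?_
  · exact Subgroup.mem_sup_left (Subgroup.inv_mem _ hQmem)
  · exact Subgroup.mem_sup_left (Subgroup.inv_mem _ hPmem)

/-- The instance used in SM1(c): `Γ₀(N) ⊔ Γ₀(N_E) = Γ₀(gcd(N, N_E))`; in particular if a function is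
invariant under both `Γ₀(N)` and `Γ₀(N_E)` it is invariant under `Γ₀(gcd(N, N_E))`. -/
theorem mem_Gamma0_gcd_iff (M₁ M₂ : ℕ) (A : SL(2, ℤ)) :
    A ∈ Gamma0 (Nat.gcd M₁ M₂) ↔ A ∈ Gamma0 M₁ ⊔ Gamma0 M₂ := by
  rw [Gamma0_sup_Gamma0]

end ManinGamma.GammaZeroSup
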